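import Mathlib
import Literature.NumberTheory.LFunctions.Zhang2022.Section4FELine
import HarnessLib

/-!
# Zhang (2022), §4 Lemma 4.4 (proof): `Z̃(s+w,ψ)` on the line `Re(s+w) = −1/2` and the
# integrability of the Perron integrands `f(w)P^{(9/5)w}ω₁(w)/w` there

Topic `Literature/NumberTheory/LFunctions/Zhang2022` (Landau–Siegel audit tree; verdict-neutral).
Y. Zhang, *Discrete mean estimates and the Landau–Siegel zero*, arXiv:2211.02515v1 (2022)
[Zhang2022LandauSiegel] — **an unrefereed manuscript under adjudication.** The proof of Lemma 4.4
[Z22 p.19, tex L1050–L1082] manipulates the smoothed Perron integrals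
`(2πi)⁻¹∫_{(−σ−1/2)} (…)P^{(9/5)w}ω₁(w)dw/w` as absolutely convergent integrals without comment.
This file supplies the analytic bookkeeping the typed proof-steps need (consumed by
`Section4ThreeWaySplit`):

* `norm_Zfac_le_of_re` — on the line `Re z = −1/2` the factor `Z(z,θ)` of (2.2) has linear size,
  `|Z(z,θ)| ≤ |τ(θ)|k^{1/2}(1 + |z|)`: indeed `|Γ((1−z)/2)/Γ(z/2)| = |z/2|` (even `θ`),
  `|Γ((2−z)/2)/Γ((1+z)/2)| = |(1+z)/2|` (odd `θ`), by `Γ(ū+1) = ūΓ(ū)` and `Γ(ū) = conj Γ(u)`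
  — the line `Re = −1/2` is the reflection of `Re = 3/2`, so no Stirling estimate is needed;
* `differentiableAt_Zfac_of_re`, `continuous_Zfac_line`, `continuous_tildeZW_line`,
  `norm_tildeZW_le_of_re` — holomorphy/continuity of `Z`, `Z̃` along that line, `|Z̃| ≪ (1+|z|)²`;
* `norm_FpolyBar_le_sum_norm`, `norm_midSum_le_sum_norm`, `norm_LSeries_le_tsum`, `LSeriesSummable_nu_psiBar`,
  `continuous_sum_cpow_line` — the Dirichlet-polynomial pieces on `Re = 3/2`;
* `integrable_perronIntegrand` — a Perron integrand on `Re w = a ≠ 0` with continuous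
  `|f(a+iv)| ≤ A(1+|v|)²` is integrable in `v` (`|ω₁(a+iv)| = e^{(a²−v²)/(4𝓛³⁰)}`).

Nothing about Theorems 1–2 of the source or about Landau–Siegel zeros is stated or implied.

## References

* Y. Zhang, arXiv:2211.02515v1 (2022), §4 p. 19 (proof of Lemma 4.4), (2.2), (4.4), (4.5).
  [cite: Zhang2022LandauSiegel, §4 Lemma 4.4 (proof)]
-/

noncomputable section

open Complex Real ComplexConjugate MeasureTheory
open scoped LSeries.notation

namespace Literature.NumberTheory.LFunctions.Zhang2022.Section4

open Skeleton

/-! ## `Z(z,θ)` on the line `Re z = −1/2` -/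

/-- `|Γ(ū + 1)·Γ(u)⁻¹| = |u|` for `u` off the poles of `Γ` (`Γ(ū+1) = ūΓ(ū) = ū·conj Γ(u)`).
[folklore] -/
private theorem norm_Gamma_conj_add_one_mul_inv {u : ℂ} (hu : ∀ m : ℕ, u ≠ -m) :
    ‖Complex.Gamma (conj u + 1) * (Complex.Gamma u)⁻¹‖ = ‖u‖ := by
  have hu0 : u ≠ 0 := by simpa using hu 0
  have hcu0 : conj u ≠ 0 := by rwa [Ne, map_eq_zero]
  have hΓ : Complex.Gamma u ≠ 0 := Complex.Gamma_ne_zero hu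
  rw [Complex.Gamma_add_one _ hcu0, Complex.Gamma_conj, norm_mul, norm_mul, norm_inv,
    Complex.norm_conj, Complex.norm_conj, mul_assoc, mul_inv_cancel₀ (norm_ne_zero_iff.mpr hΓ),
    mul_one]

/-- A point with `Re u ∉ ℤ` is not a pole of `Γ`. [folklore] -/
private theorem ne_neg_nat_of_re {u : ℂ} (hu : ∀ m : ℤ, u.re ≠ m) (m : ℕ) : u ≠ -m := by
  intro h
  apply hu (-m)
  rw [h]
  simp

/-- **`|Z(z,θ)| ≤ |τ(θ)|·k^{1/2}·(1 + |z|)` on `Re z = −1/2`** (indeed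
`|Z(z,θ)| = |τ(θ)|π⁻¹k^{1/2}|u|` with `u = z/2` resp. `(1+z)/2`): the archimedean quotient has
exactly linear size on this line. [cite: Zhang2022LandauSiegel, §4 (4.5)] -/
theorem norm_Zfac_le_of_re {k : ℕ} [NeZero k] (θ : DirichletCharacter ℂ k) {z : ℂ}
    (hz : z.re = -1 / 2) :
    ‖GammaFactor.Zfac θ z‖ ≤ ‖GammaFactor.tau θ‖ * (k : ℝ) ^ (1 / 2 : ℝ) * (1 + ‖z‖) := by
  have hk : (0 : ℝ) < k := Nat.cast_pos.mpr (NeZero.pos k)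
  have hπ : ‖(π : ℂ) ^ (z - 1 / 2)‖ ≤ 1 := by
    rw [Complex.norm_cpow_eq_rpow_re_of_pos Real.pi_pos]
    have hre : (z - 1 / 2).re = -1 := by
      rw [Complex.sub_re, hz]; norm_num
    rw [hre]
    exact Real.rpow_le_one_of_one_le_of_nonpos (by linarith [Real.pi_gt_three]) (by norm_num)
  have hkz : ‖(k : ℂ) ^ (-z)‖ = (k : ℝ) ^ (1 / 2 : ℝ) := by
    rw [Complex.norm_natCast_cpow_of_pos (NeZero.pos k), Complex.neg_re, hz]
    norm_num
  unfold GammaFactor.Zfac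
  split_ifs with he
  · -- even: `u = z/2`, `(1 − z)/2 = ū + 1`
    set u : ℂ := z / 2 with hu_def
    have hure : ∀ m : ℤ, u.re ≠ m := by
      intro m hm
      rw [hu_def, Complex.div_ofNat_re, hz] at hm
      have : (4 : ℝ) * m = -1 := by linarith
      have h' : (4 * m : ℤ) = -1 := by exact_mod_cast this
      omega
    have h1 : (1 - z) / 2 = conj u + 1 := by
      apply Complex.ext
      · simp only [hu_def, Complex.div_ofNat_re, Complex.sub_re, Complex.one_re, hz,
          Complex.add_re, Complex.conj_re]
        norm_num
      · simp only [hu_def, Complex.div_ofNat_im, Complex.sub_im, Complex.one_im,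
          Complex.add_im, Complex.conj_im, Complex.one_im]
        ring
    rw [h1]
    calc ‖GammaFactor.tau θ * (π : ℂ) ^ (z - 1 / 2) * (k : ℂ) ^ (-z) * Complex.Gamma (conj u + 1) *
          (Complex.Gamma u)⁻¹‖
        = ‖GammaFactor.tau θ‖ * ‖(π : ℂ) ^ (z - 1 / 2)‖ * ‖(k : ℂ) ^ (-z)‖ *
            ‖Complex.Gamma (conj u + 1) * (Complex.Gamma u)⁻¹‖ := by
          simp only [norm_mul, mul_assoc]
      _ = ‖GammaFactor.tau θ‖ * ‖(π : ℂ) ^ (z - 1 / 2)‖ * (k : ℝ) ^ (1 / 2 : ℝ) * ‖u‖ := by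
          rw [norm_Gamma_conj_add_one_mul_inv (ne_neg_nat_of_re hure), hkz]
      _ ≤ ‖GammaFactor.tau θ‖ * 1 * (k : ℝ) ^ (1 / 2 : ℝ) * (1 + ‖z‖) := by
          gcongr
          rw [hu_def, norm_div, Complex.norm_ofNat]
          linarith [norm_nonneg z]
      _ = ‖GammaFactor.tau θ‖ * (k : ℝ) ^ (1 / 2 : ℝ) * (1 + ‖z‖) := by ring
  · -- odd: `u = (1 + z)/2`, `(2 − z)/2 = ū + 1`
    set u : ℂ := (1 + z) / 2 with hu_def
    have hure : ∀ m : ℤ, u.re ≠ m := by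
      intro m hm
      rw [hu_def, Complex.div_ofNat_re, Complex.add_re, Complex.one_re, hz] at hm
      have : (4 : ℝ) * m = 1 := by linarith
      have h' : (4 * m : ℤ) = 1 := by exact_mod_cast this
      omega
    have h1 : (2 - z) / 2 = conj u + 1 := by
      apply Complex.ext
      · simp only [hu_def, Complex.div_ofNat_re, Complex.sub_re, hz, Complex.add_re,
          Complex.conj_re, Complex.one_re, Complex.re_ofNat]
        norm_num
      · simp only [hu_def, Complex.div_ofNat_im, Complex.sub_im, Complex.im_ofNat,
          Complex.add_im, Complex.conj_im, Complex.one_im]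
        ring
    rw [h1]
    calc ‖-I * GammaFactor.tau θ * (π : ℂ) ^ (z - 1 / 2) * (k : ℂ) ^ (-z) *
          Complex.Gamma (conj u + 1) * (Complex.Gamma u)⁻¹‖
        = ‖GammaFactor.tau θ‖ * ‖(π : ℂ) ^ (z - 1 / 2)‖ * ‖(k : ℂ) ^ (-z)‖ *
            ‖Complex.Gamma (conj u + 1) * (Complex.Gamma u)⁻¹‖ := by
          simp only [norm_mul, norm_neg, Complex.norm_I, one_mul, mul_assoc]
      _ = ‖GammaFactor.tau θ‖ * ‖(π : ℂ) ^ (z - 1 / 2)‖ * (k : ℝ) ^ (1 / 2 : ℝ) * ‖u‖ := by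
          rw [norm_Gamma_conj_add_one_mul_inv (ne_neg_nat_of_re hure), hkz]
      _ ≤ ‖GammaFactor.tau θ‖ * 1 * (k : ℝ) ^ (1 / 2 : ℝ) * (1 + ‖z‖) := by
          gcongr
          rw [hu_def, norm_div, Complex.norm_ofNat]
          linarith [norm_nonneg z, norm_add_le (1 : ℂ) z, norm_one (α := ℂ)]
      _ = ‖GammaFactor.tau θ‖ * (k : ℝ) ^ (1 / 2 : ℝ) * (1 + ‖z‖) := by ring

/-- **`Z(·,θ)` is holomorphic at every point of the line `Re z = −1/2`** (the `Γ`-arguments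
`(1−z)/2`, `(2−z)/2` have real parts `3/4`, `5/4`; `Γ⁻¹` is entire). [cite: Zhang2022LandauSiegel, §2 (2.2)] -/
theorem differentiableAt_Zfac_of_re {k : ℕ} [NeZero k] (θ : DirichletCharacter ℂ k) {z : ℂ}
    (hz : z.re = -1 / 2) : DifferentiableAt ℂ (GammaFactor.Zfac θ) z := by
  have hk : (k : ℂ) ≠ 0 := Nat.cast_ne_zero.mpr (NeZero.ne k)
  have hπ : (π : ℂ) ≠ 0 := ofReal_ne_zero.mpr Real.pi_ne_zero
  have hkd : DifferentiableAt ℂ (fun w : ℂ => (k : ℂ) ^ (-w)) z :=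
    ((hasStrictDerivAt_const_cpow (Or.inl hk)).hasDerivAt.comp z (hasDerivAt_neg z)).differentiableAt
  have hπd : DifferentiableAt ℂ (fun w : ℂ => (π : ℂ) ^ (w - 1 / 2)) z :=
    ((hasStrictDerivAt_const_cpow (Or.inl hπ)).hasDerivAt.comp z
      ((hasDerivAt_id z).sub_const _)).differentiableAt
  have hinv : ∀ g : ℂ → ℂ, DifferentiableAt ℂ g z →
      DifferentiableAt ℂ (fun w => (Complex.Gamma (g w))⁻¹) z := fun g hg =>
    (Complex.differentiable_one_div_Gamma (g z)).comp z hg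
  have hGam : ∀ g : ℂ → ℂ, DifferentiableAt ℂ g z → (∀ m : ℤ, (g z).re ≠ m) →
      DifferentiableAt ℂ (fun w => Complex.Gamma (g w)) z := fun g hg hre =>
    (Complex.differentiableAt_Gamma _ (ne_neg_nat_of_re hre)).comp z hg
  unfold GammaFactor.Zfac
  split_ifs with he
  · have hg1 : DifferentiableAt ℂ (fun w : ℂ => (1 - w) / 2) z :=
      ((differentiableAt_const _).sub differentiableAt_id).div_const _
    have hre1 : ∀ m : ℤ, ((1 - z) / 2).re ≠ m := by
      intro m hm
      simp only [Complex.div_ofNat_re, Complex.sub_re, Complex.one_re, hz] at hm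
      have : (4 : ℝ) * m = 3 := by linarith
      have h' : (4 * m : ℤ) = 3 := by exact_mod_cast this
      omega
    have hg2 : DifferentiableAt ℂ (fun w : ℂ => w / 2) z := differentiableAt_id.div_const _
    exact ((((differentiableAt_const _).mul hπd).mul hkd).mul (hGam _ hg1 hre1)).mul (hinv _ hg2)
  · have hg1 : DifferentiableAt ℂ (fun w : ℂ => (2 - w) / 2) z :=
      ((differentiableAt_const _).sub differentiableAt_id).div_const _
    have hre1 : ∀ m : ℤ, ((2 - z) / 2).re ≠ m := by
      intro m hm
      simp only [Complex.div_ofNat_re, Complex.sub_re, Complex.re_ofNat, hz] at hm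
      have : (4 : ℝ) * m = 5 := by linarith
      have h' : (4 * m : ℤ) = 5 := by exact_mod_cast this
      omega
    have hg2 : DifferentiableAt ℂ (fun w : ℂ => (1 + w) / 2) z :=
      ((differentiableAt_const _).add differentiableAt_id).div_const _
    exact (((((differentiableAt_const _).mul hπd).mul hkd).mul (hGam _ hg1 hre1)).mul (hinv _ hg2))

/-- `Z(·,θ)` is continuous along any vertical line `Re = −1/2`. [cite: Zhang2022LandauSiegel, §2 (2.2)] -/
theorem continuous_Zfac_line {k : ℕ} [NeZero k] (θ : DirichletCharacter ℂ k) {c : ℂ}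
    (hc : c.re = -1 / 2) : Continuous fun v : ℝ => GammaFactor.Zfac θ (c + v * I) := by
  refine continuous_iff_continuousAt.mpr fun v => ?_
  have hz : (c + v * I).re = -1 / 2 := by simp [hc]
  have h2 : ContinuousAt (fun v : ℝ => c + (v : ℂ) * I) v :=
    (by fun_prop : Continuous fun v : ℝ => c + (v : ℂ) * I).continuousAt
  change ContinuousAt (GammaFactor.Zfac θ ∘ fun v : ℝ => c + (v : ℂ) * I) v
  exact ContinuousAt.comp (f := fun v : ℝ => c + (v : ℂ) * I) (x := v)
    (differentiableAt_Zfac_of_re θ hz).continuousAt h2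

section WithCharacter

variable {D : ℕ} [NeZero D] (χ : DirichletCharacter ℂ D) (x : Chr D)

/-- **`|Z̃(z,ψ)| ≤ C_ψ C_{ψχ}(1 + |z|)²` on `Re z = −1/2`** (`C_θ = |τ(θ)|k^{1/2}`).
[cite: Zhang2022LandauSiegel, §4 (4.5)] -/
theorem norm_tildeZW_le_of_re {z : ℂ} (hz : z.re = -1 / 2) :
    ‖tildeZW χ x z‖ ≤ (‖GammaFactor.tau x.ψ‖ * (x.p : ℝ) ^ (1 / 2 : ℝ)) *
      (‖GammaFactor.tau (psiChi χ x)‖ * ((D * x.p : ℕ) : ℝ) ^ (1 / 2 : ℝ)) * (1 + ‖z‖) ^ 2 := by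
  rw [tildeZW, GammaFactor.tildeZ_def, norm_mul]
  have h1 := norm_Zfac_le_of_re x.ψ hz
  have h2 := norm_Zfac_le_of_re (psiChi χ x) hz
  have h0 : 0 ≤ ‖GammaFactor.tau x.ψ‖ * (x.p : ℝ) ^ (1 / 2 : ℝ) * (1 + ‖z‖) :=
    le_trans (norm_nonneg _) h1
  calc ‖GammaFactor.Zfac x.ψ z‖ * ‖GammaFactor.Zfac (psiChi χ x) z‖
      ≤ (‖GammaFactor.tau x.ψ‖ * (x.p : ℝ) ^ (1 / 2 : ℝ) * (1 + ‖z‖)) *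
          (‖GammaFactor.tau (psiChi χ x)‖ * ((D * x.p : ℕ) : ℝ) ^ (1 / 2 : ℝ) * (1 + ‖z‖)) :=
        mul_le_mul h1 h2 (norm_nonneg _) h0
    _ = _ := by ring

/-- `Z̃(·,ψ)` is continuous along any vertical line `Re = −1/2`. [cite: Zhang2022LandauSiegel, §4 (4.4)] -/
theorem continuous_tildeZW_line {c : ℂ} (hc : c.re = -1 / 2) :
    Continuous fun v : ℝ => tildeZW χ x (c + v * I) := by
  have h : (fun v : ℝ => tildeZW χ x (c + v * I)) = fun v : ℝ =>
      GammaFactor.Zfac x.ψ (c + v * I) * GammaFactor.Zfac (psiChi χ x) (c + v * I) := by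
    funext v; rw [tildeZW, GammaFactor.tildeZ_def]
  rw [h]
  exact (continuous_Zfac_line x.ψ hc).mul (continuous_Zfac_line (psiChi χ x) hc)

omit [NeZero D] in
/-- A finite Dirichlet polynomial `Σ_{n∈S} c(n)n^{−z}` (with `0 ∉ S`) has norm at most `Σ_{n∈S}|c(n)|`
for `Re z ≥ 0`. [folklore] -/
private theorem norm_sum_mul_cpow_neg_le (S : Finset ℕ) (hS : 0 ∉ S) (c : ℕ → ℂ) {z : ℂ}
    (hz : 0 ≤ z.re) : ‖∑ n ∈ S, c n * (n : ℂ) ^ (-z)‖ ≤ ∑ n ∈ S, ‖c n‖ := by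
  refine (norm_sum_le _ _).trans (Finset.sum_le_sum fun n hn => ?_)
  have hn0 : 0 < n := Nat.pos_of_ne_zero fun h => hS (h ▸ hn)
  rw [norm_mul, Complex.norm_natCast_cpow_of_pos hn0, Complex.neg_re]
  have : (n : ℝ) ^ (-z.re) ≤ 1 :=
    Real.rpow_le_one_of_one_le_of_nonpos (by exact_mod_cast hn0) (by linarith)
  exact mul_le_of_le_one_right (norm_nonneg _) this

omit [NeZero D] in
/-- `|F(z,ψ̄)| ≤ Σ_{n≤D⁴}|ν(n)|` for `Re z ≥ 0`. [cite: Zhang2022LandauSiegel, §4 Lemma 4.4] -/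
theorem norm_FpolyBar_le_sum_norm {z : ℂ} (hz : 0 ≤ z.re) :
    ‖FpolyBar χ x z‖ ≤ ∑ n ∈ Finset.Icc 1 (D ^ 4), ‖nu χ n‖ := by
  refine (norm_sum_mul_cpow_neg_le _ (by simp) _ hz).trans (Finset.sum_le_sum fun n _ => ?_)
  rw [norm_mul]
  exact mul_le_of_le_one_right (norm_nonneg _)
    ((Complex.norm_conj _).le.trans (x.ψ.norm_le_one _))

omit [NeZero D] in
/-- `|midSum(z)| ≤ Σ_{D⁴<n≤P²}|ν(n)|` for `Re z ≥ 0`. [cite: Zhang2022LandauSiegel, §4 (4.8)] -/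
theorem norm_midSum_le_sum_norm {z : ℂ} (hz : 0 ≤ z.re) :
    ‖midSum χ x z‖ ≤ ∑ n ∈ Finset.Ioc (D ^ 4) ⌊bigP D ^ 2⌋₊, ‖nu χ n‖ := by
  refine (norm_sum_mul_cpow_neg_le _ (by simp) _ hz).trans (Finset.sum_le_sum fun n _ => ?_)
  rw [norm_mul, psiBarFn]
  exact mul_le_of_le_one_right (norm_nonneg _)
    ((Complex.norm_conj _).le.trans (x.ψ.norm_le_one _))

omit [NeZero D] in
/-- Continuity in `v` of a finite Dirichlet polynomial evaluated at `1 − s − (a + iv)` (the pieces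
`F(1−s−w,ψ̄)`, `Σ_{D⁴<n≤P²}…` of the proof of Lemma 4.4). [cite: Zhang2022LandauSiegel, §4 Lemma 4.4 (proof)] -/
theorem continuous_sum_cpow_line (S : Finset ℕ) (hS : 0 ∉ S) (c : ℕ → ℂ) (s : ℂ) (a : ℝ) :
    Continuous fun v : ℝ => ∑ n ∈ S, c n * (n : ℂ) ^ (-(1 - s - (a + v * I))) := by
  refine continuous_finsetSum S fun n hn => ?_
  have hn0 : (n : ℂ) ≠ 0 := by
    exact_mod_cast (Nat.pos_of_ne_zero fun h => hS (h ▸ hn)).ne'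
  exact continuous_const.mul ((by fun_prop : Continuous fun v : ℝ => -(1 - s - (a + v * I))).const_cpow
    (Or.inl hn0))

omit [NeZero D] in
/-- The coefficients `νψ̄` have a summable Dirichlet series for `Re z > 1`.
[cite: Zhang2022LandauSiegel, §4 Lemma 4.4 (proof)] -/
theorem LSeriesSummable_nu_psiBar (hq : χ.IsQuadratic) {z : ℂ} (hz : 1 < z.re) :
    LSeriesSummable (fun n => nu χ n * psiBarFn x n) z :=
  (LSeriesSummable_congr z fun {n} _ => convolution_psiBar_psiChiBar χ x hq n).mp
    ((DirichletCharacter.LSeriesSummable_of_one_lt_re _ hz).convolution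
      (DirichletCharacter.LSeriesSummable_of_one_lt_re _ hz))

omit [NeZero D] in
/-- A Dirichlet series is bounded on a vertical line by the sum of the norms of its terms there
(the size of `Σₙ ν(n)ψ̄(n)n^{−(1−s−w)}` on `Re = 3/2` in the proof of Lemma 4.4).
[cite: Zhang2022LandauSiegel, §4 Lemma 4.4 (proof)] -/
theorem norm_LSeries_le_tsum {g : ℕ → ℂ} {σ₀ : ℝ} (hg : LSeriesSummable g σ₀) {z : ℂ}
    (hz : z.re = σ₀) : ‖LSeries g z‖ ≤ ∑' n, ‖LSeries.term g σ₀ n‖ := by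
  have hre : (σ₀ : ℂ).re ≤ z.re := by simp [hz]
  have hgz : LSeriesSummable g z := hg.of_re_le_re hre
  have h1 : Summable fun n => ‖LSeries.term g z n‖ := hgz.norm
  have h2 : Summable fun n => ‖LSeries.term g σ₀ n‖ := hg.norm
  exact (norm_tsum_le_tsum_norm h1).trans
    (h1.tsum_le_tsum (fun n => LSeries.norm_term_le_of_re_le_re g hre n) h2)

/-! ## Integrability of a Perron integrand along `Re w = a ≠ 0` -/

omit [NeZero D] in
/-- The norm of the Perron integrand on `Re w = a`: `|f(w)|·P^{(9/5)a}·e^{(a²−v²)/(4𝓛³⁰)}/|w|`.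
[cite: Zhang2022LandauSiegel, §4 p. 19] -/
theorem norm_perronIntegrand (f : ℂ → ℂ) (a v : ℝ) :
    ‖perronIntegrand D f (a + v * I)‖ = ‖f (a + v * I)‖ * bigP D ^ ((9 / 5 : ℝ) * a) *
      Real.exp ((a ^ 2 - v ^ 2) / (4 * ell D ^ 30)) / ‖(a : ℂ) + v * I‖ := by
  have hP : 0 < bigP D := Real.exp_pos _
  rw [perronIntegrand, norm_div, norm_mul, norm_mul, omega1W, GaussWeight.norm_omega1,
    Complex.norm_cpow_eq_rpow_re_of_pos hP]
  congr 3
  simp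
  
omit [NeZero D] in
/-- **Integrability of a Perron integrand**: if `f` is continuous on the line `Re w = a ≠ 0` with
`|f(a+iv)| ≤ A(1+|v|)²`, then `v ↦ f(w)P^{(9/5)w}ω₁(w)/w` (`w = a + iv`) is integrable on `ℝ`
(Gaussian decay of `ω₁`). [cite: Zhang2022LandauSiegel, §4 p. 19] -/
theorem integrable_perronIntegrand {a : ℝ} (ha : a ≠ 0) {f : ℂ → ℂ}
    (hf : Continuous fun v : ℝ => f (a + v * I)) {A : ℝ}
    (hA : ∀ v : ℝ, ‖f (a + v * I)‖ ≤ A * (1 + |v|) ^ 2) (hL : 0 < ell D) :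
    Integrable fun v : ℝ => perronIntegrand D f (a + v * I) := by
  have hP : 0 < bigP D := Real.exp_pos _
  -- the dominating function
  set b : ℝ := 1 / (4 * ell D ^ 30) with hb
  have hb0 : 0 < b := by rw [hb]; positivity
  set M : ℝ := bigP D ^ ((9 / 5 : ℝ) * a) * Real.exp (a ^ 2 / (4 * ell D ^ 30)) with hM
  have hM0 : 0 ≤ M := by rw [hM]; positivity
  set K : ℝ := A * M / |a| with hK
  have hg1 : Integrable fun v : ℝ => Real.exp (-b * v ^ 2) := integrable_exp_neg_mul_sq hb0
  have hg2 : Integrable fun v : ℝ => |v| * Real.exp (-b * v ^ 2) := by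
    have := (integrable_mul_exp_neg_mul_sq hb0).norm
    simpa [Real.norm_eq_abs, abs_mul, abs_of_pos (Real.exp_pos _)] using this
  have hg3 : Integrable fun v : ℝ => v ^ 2 * Real.exp (-b * v ^ 2) := by
    have := integrable_rpow_mul_exp_neg_mul_sq hb0 (show (-1 : ℝ) < 2 by norm_num)
    simpa [Real.rpow_two] using this
  have hg : Integrable fun v : ℝ => K * ((1 + |v|) ^ 2 * Real.exp (-b * v ^ 2)) := by
    have h123 : Integrable fun v : ℝ =>
        Real.exp (-b * v ^ 2) + 2 * (|v| * Real.exp (-b * v ^ 2)) + v ^ 2 * Real.exp (-b * v ^ 2) :=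
      (hg1.add (hg2.const_mul 2)).add hg3
    refine (h123.const_mul K).congr (ae_of_all _ fun v => ?_)
    have : |v| ^ 2 = v ^ 2 := sq_abs v
    simp only
    rw [← this]
    ring
  -- measurability
  have hcont : Continuous fun v : ℝ => perronIntegrand D f (a + v * I) := by
    have hw : ∀ v : ℝ, (a : ℂ) + v * I ≠ 0 := fun v h => ha (by simpa using congrArg Complex.re h)
    unfold perronIntegrand omega1W GaussWeight.omega1
    refine Continuous.div ?_ (by fun_prop) hw
    refine (hf.mul ?_).mul (by fun_prop)
    exact Continuous.const_cpow (by fun_prop) (Or.inl (by exact_mod_cast hP.ne'))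
  refine hg.mono' hcont.aestronglyMeasurable (ae_of_all _ fun v => ?_)
  rw [norm_perronIntegrand]
  have hw : |a| ≤ ‖(a : ℂ) + v * I‖ := by
    simpa using Complex.abs_re_le_norm ((a : ℂ) + v * I)
  have ha' : 0 < |a| := abs_pos.mpr ha
  have hexp : Real.exp ((a ^ 2 - v ^ 2) / (4 * ell D ^ 30))
      = Real.exp (a ^ 2 / (4 * ell D ^ 30)) * Real.exp (-b * v ^ 2) := by
    rw [← Real.exp_add, hb]; congr 1; ring
  have hAv : 0 ≤ A * (1 + |v|) ^ 2 := le_trans (norm_nonneg _) (hA v)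
  rw [hexp]
  calc ‖f (a + v * I)‖ * bigP D ^ ((9 / 5 : ℝ) * a) *
        (Real.exp (a ^ 2 / (4 * ell D ^ 30)) * Real.exp (-b * v ^ 2)) / ‖(a : ℂ) + v * I‖
      = ‖f (a + v * I)‖ * (M * Real.exp (-b * v ^ 2)) / ‖(a : ℂ) + v * I‖ := by rw [hM]; ring
    _ ≤ A * (1 + |v|) ^ 2 * (M * Real.exp (-b * v ^ 2)) / ‖(a : ℂ) + v * I‖ := by
        gcongr
        exact hA v
    _ ≤ A * (1 + |v|) ^ 2 * (M * Real.exp (-b * v ^ 2)) / |a| :=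
        div_le_div_of_nonneg_left (by positivity) ha' hw
    _ = K * ((1 + |v|) ^ 2 * Real.exp (-b * v ^ 2)) := by rw [hK]; ring

end WithCharacter

end Literature.NumberTheory.LFunctions.Zhang2022.Section4
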